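import Mathlib
import Literature.NumberTheory.LFunctions.Zhang2022.Section12Eq1212Holds
import Literature.NumberTheory.LFunctions.Zhang2022.Section12RelEdgesA
import Literature.NumberTheory.LFunctions.Zhang2022.Section18SjNormMajorant
import HarnessLib

/-!
# Zhang (2022) §12 (12.12) from (12.10) in the EULER-MAJORANT currency: the leaf `Typed.Sec12C.Eq1212 c′`
# as an edge from `Typed.Sec12B.Eq1210L15RelA c′` (error `C𝓛⁻¹⁵·∏_{q∣dr}(1 + A/q)`, `∃ A ≥ 0`)

Topic `Literature/NumberTheory/LFunctions/Zhang2022` (Landau–Siegel audit tree; verdict-neutral).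
Y. Zhang, *Discrete mean estimates and the Landau–Siegel zero*, arXiv:2211.02515v1 (2022)
[Zhang2022LandauSiegel] — **an unrefereed manuscript under adjudication; this theorem-only file proves one
typed CLAIM node of its §12 from another typed node and asserts nothing about its Theorems 1–2 or about
Landau–Siegel zeros** (lane ZHANG-L, WP12, seat zl-w12-p4; leaf `h1212` of
`Skeleton.theorem1_of_leaves_v26`; WP12-PLAN batch 2 (B3) + zl-w12-typer 2026-08-27T01:06Z / zl-w12-plan
ADDENDUM 01:07Z / zl-w12-ref-2 01:07Z: "consume `Eq1210L15RelA`"; companion of zl-w12-p10's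
`Section12Eq1212Holds` (absolute Lemma 12.2) and `Section12Eq1212OfRel` (currency `(∏_{q∣dr}(1−q⁻¹)⁻¹)²`)).

The node [Z22 p.71, (12.12), tex L3605–L3612]: "By Lemma 8.2, 8.3 and 12.2, the sum over `dr ≤ P″₁/T` is
equal to `L′(1,χ)²b*β_{j+1}β_{j+2}Σ_{n<P^{0.496}}|χ(n)|λ₀ⱼ(n)φ(n)⁻¹(ῑ₃𝓕_{j6}(P^{0.498}/n)/0.498 +
ῑ₄𝓕_{j7}(P^{0.5}/n)/0.5) + o(α) = 𝔞b*(log P)β_{j+1}β_{j+2}∫₀^{0.496}(…)dz + o(α)`" — typed as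
`Typed.Sec12C.Eq1212 c′`. Its input (12.10) [error term BLANK in print, GAP row G-L3t5-1] is typed in three
currencies: absolutely (`Sec12B.Eq1210`, `TypedSection12B`), with the Lemma 8.3/8.4 factor
`(∏_{q∣dr}(1−q⁻¹)⁻¹)²` (`Sec12B.Eq1210L15Rel`), and — the weakest, and the one the u024 unsmoothing step
("By (4) and (4)", short-interval means of `|ξ₀ⱼ|`) actually reaches (referee remark zl-w12-ref-1
2026-08-27T00:32Z (R1), `TypedSection12BRel` rev 2) — with an Euler majorant `∏_{q∣dr}(1 + A/q)`, `∃ A ≥ 0`: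
`Sec12B.Eq1210LeRelA`/`Eq1210L15RelA` (`TypedSection12BRel` :242–250), on the CLOSED range `dr ≤ P″₁/T`
(= `Sec12C.rngLow`, so no (12.11) input is needed at the boundary point). This file is the consumer edge
out of that weakest currency; the other two follow from it (`Sec12B.eq1210L15RelA_of_eq1210L15Rel`,
`Section12RelEdgesA`).

PROVED HERE:

* `range_assembly_bound_weighted` — the toolkit's abstract range assembly (`Skeleton.range_assembly_bound`)
  with the tolerance of the second factor carrying an arbitrary weight `W(n) ≥ 1`,
  `‖N − c₀ΠG‖ ≤ e_N·W(n)`; the contributions are weighted by `|a(n)|(n/φ(n))W(n)` (pure bookkeeping);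
* `ratio_pow_seven_mul_prod_le` — `(n/φ(n))⁷·∏_{q∣n}(1 + A/q) ≤ ∏_{q∣n}(1 + (254 + 128A)/q)` (per prime:
  `(q/(q−1))⁷(1 + A/q) ≤ (1 + 2/q)⁷(1 + A/q) ≤ (1 + 254/q)(1 + A/q) ≤ 1 + (254 + 128A)/q`);
* `sum_weights_main_relA_le` — `Σ_{n≤Y}|χ(n)|λ₀ⱼ(n)n⁻¹(n/φ(n))³∏_{q∣n}(1 + A/q) ≤ e^{254+128A}(1 + log Y)`
  (`|λ₀ⱼ(n)| ≤ (n/φ(n))⁴`, `Ranges1422.norm_weight_mul_cube_le`; `Σ_{n≤X}n⁻¹∏_{q∣n}(1 + c/q) ≤ eᶜ(1 + log X)`,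
  `Sec18SjNorm.sum_prod_one_add_div_le`);
* `eq1212_first_core_relA` — (12.12), first equality, at a fixed modulus, from Lemma 8.2's two evaluations and
  (12.10) with error `C₁₀𝓛⁻¹⁵∏_{q∣dr}(1 + A/q)`: `‖S_j(𝐚₁₂,𝐚₂₅)|_{dr≤P″₁/T} − main1212sum‖ ≤ K_A𝓛⁻¹²`;
* `eq1212_first_of_eq1210L15RelA : Lemma82 c′ → Sec12B.Eq1210L15RelA c′ → (first equality, ≤ εα)`;
* `eq1212_of_eq1210L15RelA : Lemma82 c′ → Sec12B.Eq1210L15RelA c′ → Eq1212 c′`;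
* `eq1212_of_eq1210L15RelA' : 0 ≤ c′ → Sec12B.Eq1210L15RelA c′ → Eq1212 c′` — the closer shape
  (`Skeleton.lemma82_holds hc′`); plug `h1212 := eq1212_of_eq1210L15RelA' hc' (eq1210L15RelA_holds c')`;
* `eq1212_of_u024RelA_u025Rel : 0 ≤ c′ → Sec12B.U024RelA c′ → Sec12B.U025Rel c′ → Eq1212 c′` (via the
  PROVED edge `Sec12B.eq1210L15RelA_of_u024RelA_u025Rel`, `Section12RelEdgesA`).

## The argument

Identical to `Section12Eq1212Holds` (zl-w12-p10) except at one point: after `n = dr`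
(`SjOn_a12_a25_eq_divisor_sum`) the second factor `N(d,r) = Σ_lχ(l)ϰ̄₁₃(drl)ξ₀ⱼ(l;d,r)/l` is now
`c₀Π(d,r) + O(𝓛⁻¹⁵·∏_{q∣n}(1 + A/q))` on ALL of `n ≤ P″₁/T`, so the weighted assembly
`range_assembly_bound_weighted` (weight `W(n) = (n/φ(n))²∏_{q∣n}(1 + A/q) ≥ 1`) replaces
`range_assembly_bound₂`, and the weight total `Σ_{n≤P″₁/T}|χ(n)|λ₀ⱼ(n)n⁻¹(n/φ(n))³∏_{q∣n}(1 + A/q) ≤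
e^{254+128A}(1 + log(P″₁/T)) ≪_A 𝓛⁹` replaces `sum_weights_main_le`; the window `P″₁/T < n < P^{0.496}` of the
printed main term is handled verbatim (`Ranges1422.sum_weights_le`, `norm_Fpr_le`). Total `K_A𝓛⁻¹² ≤ εα`
once `𝓛 ≥ K_A/(επ) + 5`. No new definitions, no named facts; standard axioms.

## References

* Y. Zhang, arXiv:2211.02515v1 (2022), §12 (12.12) p.71 (tex L3600–L3612), Lemma 12.2 (12.10) p.69;
  §8 Lemma 8.2, Lemma 8.3, (8.10) pp.45–48. [cite: Zhang2022LandauSiegel, §12 (12.12) p.71]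
* R. R. Hall, G. Tenenbaum, *Divisors*, CUP 1988, §0.2 (`Σ_{n≤x}n⁻¹∏_{q∣n}(1 + c/q) ≪_c log x`).
  [cite: HallTenenbaum1988, §0.2]
-/

noncomputable section

open Complex Real ComplexConjugate
open Literature.NumberTheory.LFunctions.Zhang2022.Skeleton

namespace Literature.NumberTheory.LFunctions.Zhang2022.Typed.Sec12C

open Literature.NumberTheory.LFunctions.Zhang2022.Typed.Sec10C.Ranges1422

/-! ## Abstract assembly with a weighted tolerance -/

section Assembly

/-- **Abstract range assembly, weighted-tolerance variant** (as the toolkit's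
`Skeleton.range_assembly_bound`, main points only): after `n = dr`, a `(d,r)`-sum
`Σ_n Σ_{r∣n, r sqfree} a(n)φ(r)⁻¹ M(n) N(n/r, r)` in which the second factor is `c₀Π(n/r,r)G(n)` up to
`e_N·W(n)` with a weight `W(n) ≥ 1`, while `M = M₀ + O(e_M)`, `|M₀| ≤ B_M`, `|G| ≤ B_G`, differs from the
collapsed main term `Σ_n a(n)(n/φ(n))M₀(n)c₀G(n)` (collapse by (8.10): `Σ_{r∣n sqfree}Π(n/r,r)/φ(r) = n/φ(n)`)
by at most `Σ_n |a(n)|(n/φ(n))W(n)·((B_M+e_M)e_N + e_M|c₀|B_G)`. Pure finite-sum bookkeeping.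
[cite: Zhang2022LandauSiegel, §10 p.57; §12 p.71] -/
theorem range_assembly_bound_weighted {S : Finset ℕ} (hS : ∀ n ∈ S, n ≠ 0)
    (a M M₀ G : ℕ → ℂ) (N Pw : ℕ → ℕ → ℂ) (c₀ : ℂ) (W : ℕ → ℝ)
    {eM BM BG eN : ℝ} (heM : 0 ≤ eM) (hBM : 0 ≤ BM) (hW1 : ∀ n ∈ S, 1 ≤ W n)
    (hPi : ∀ n ∈ S,
      ∑ r ∈ n.divisors with Squarefree r, (1 / (Nat.totient r : ℂ)) * Pw (n / r) r =
        (n : ℂ) / (Nat.totient n : ℂ))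
    (hM : ∀ n ∈ S, ‖M n - M₀ n‖ ≤ eM) (hM₀ : ∀ n ∈ S, ‖M₀ n‖ ≤ BM) (hG : ∀ n ∈ S, ‖G n‖ ≤ BG)
    (hN : ∀ n ∈ S, ∀ r ∈ n.divisors, Squarefree r →
      ‖N (n / r) r - c₀ * Pw (n / r) r * G n‖ ≤ eN * W n) :
    ‖(∑ n ∈ S, ∑ r ∈ n.divisors,
        (if Squarefree r then a n / (Nat.totient r : ℂ) * M n * N (n / r) r else 0)) -
      ∑ n ∈ S, a n * ((n : ℂ) / (Nat.totient n : ℂ)) * (M₀ n * c₀ * G n)‖ ≤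
      (∑ n ∈ S, ‖a n‖ * ((n : ℝ) / Nat.totient n) * W n) *
          ((BM + eM) * eN + eM * ‖c₀‖ * BG) := by
  classical
  set L : ℕ → ℂ := fun n => ∑ r ∈ n.divisors,
    (if Squarefree r then a n / (Nat.totient r : ℂ) * M n * N (n / r) r else 0) with hL
  set R : ℕ → ℂ := fun n => a n * ((n : ℂ) / (Nat.totient n : ℂ)) * (M₀ n * c₀ * G n) with hR
  have hBG : ∀ n ∈ S, 0 ≤ BG := fun n hn => (norm_nonneg _).trans (hG n hn)
  have hφsum : ∀ n ∈ S, ∑ r ∈ n.divisors with Squarefree r, (1 / (Nat.totient r : ℝ)) =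
      (n : ℝ) / Nat.totient n := fun n hn => sum_sqfree_divisors_inv_totient (hS n hn)
  have hφpos : ∀ r : ℕ, r ≠ 0 → (0 : ℝ) < Nat.totient r := fun r hr => by
    exact_mod_cast Nat.totient_pos.mpr (Nat.pos_of_ne_zero hr)
  have hLeq : ∀ n ∈ S, L n = a n * M n *
      ∑ r ∈ n.divisors with Squarefree r, N (n / r) r / (Nat.totient r : ℂ) := by
    intro n hn
    rw [hL]
    simp only
    rw [Finset.sum_filter, Finset.mul_sum]
    refine Finset.sum_congr rfl fun r _ => ?_
    split_ifs
    · ring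
    · simp
  have hnφC : ∀ n : ℕ, ‖((n : ℂ) / (Nat.totient n : ℂ))‖ = (n : ℝ) / Nat.totient n := by
    intro n; rw [norm_div, Complex.norm_natCast, Complex.norm_natCast]
  have main_bound : ∀ n ∈ S,
      ‖L n - R n‖ ≤ ‖a n‖ * ((n : ℝ) / Nat.totient n) * W n * ((BM + eM) * eN + eM * ‖c₀‖ * BG) := by
    intro n hn
    have hW := hW1 n hn
    have hW0 : 0 ≤ W n := zero_le_one.trans hW
    have hMle : ‖M n‖ ≤ BM + eM := by
      have h2 : ‖M n‖ ≤ ‖M₀ n‖ + ‖M n - M₀ n‖ := norm_le_norm_add_norm_sub' (M n) (M₀ n)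
      linarith [hM n hn, hM₀ n hn]
    set Err : ℂ := ∑ r ∈ n.divisors with Squarefree r,
      (N (n / r) r - c₀ * Pw (n / r) r * G n) / (Nat.totient r : ℂ) with hErr
    have hsplit : ∑ r ∈ n.divisors with Squarefree r, N (n / r) r / (Nat.totient r : ℂ) =
        c₀ * G n * ((n : ℂ) / (Nat.totient n : ℂ)) + Err := by
      rw [← hPi n hn, hErr, Finset.mul_sum, ← Finset.sum_add_distrib]
      refine Finset.sum_congr rfl fun r _ => ?_
      ring
    have hErr_le : ‖Err‖ ≤ eN * W n * ((n : ℝ) / Nat.totient n) := by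
      have step : ‖Err‖ ≤ ∑ r ∈ n.divisors with Squarefree r,
          eN * W n * (1 / (Nat.totient r : ℝ)) := by
        rw [hErr]
        refine (norm_sum_le _ _).trans (Finset.sum_le_sum fun r hr => ?_)
        have hr := Finset.mem_filter.mp hr
        have hr0 : r ≠ 0 := Nat.pos_iff_ne_zero.mp (Nat.pos_of_mem_divisors hr.1)
        rw [norm_div, Complex.norm_natCast, div_eq_mul_one_div]
        exact mul_le_mul_of_nonneg_right (hN n hn r hr.1 hr.2) (by
          have := hφpos r hr0; positivity)
      rw [← Finset.mul_sum, hφsum n hn] at step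
      exact step
    have hdiff : L n - R n =
        a n * (M n - M₀ n) * (c₀ * G n) * ((n : ℂ) / (Nat.totient n : ℂ)) + a n * M n * Err := by
      rw [hLeq n hn, hsplit, hR]
      ring
    rw [hdiff]
    refine (norm_add_le _ _).trans ?_
    rw [norm_mul, norm_mul, norm_mul, norm_mul, norm_mul, norm_mul, hnφC]
    have hratio : 0 ≤ (n : ℝ) / Nat.totient n := by positivity
    have t1 : ‖a n‖ * ‖M n - M₀ n‖ * (‖c₀‖ * ‖G n‖) * ((n : ℝ) / Nat.totient n) ≤
        ‖a n‖ * eM * (‖c₀‖ * BG) * (((n : ℝ) / Nat.totient n) * W n) := by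
      have hBG0 := hBG n hn
      have hle : (n : ℝ) / Nat.totient n ≤ (n : ℝ) / Nat.totient n * W n :=
        le_mul_of_one_le_right hratio hW
      gcongr
      · exact hM n hn
      · exact hG n hn
    have t2 : ‖a n‖ * ‖M n‖ * ‖Err‖ ≤
        ‖a n‖ * (BM + eM) * (eN * W n * ((n : ℝ) / Nat.totient n)) := by
      gcongr
    calc ‖a n‖ * ‖M n - M₀ n‖ * (‖c₀‖ * ‖G n‖) * ((n : ℝ) / ↑n.totient) + ‖a n‖ * ‖M n‖ * ‖Err‖
        ≤ ‖a n‖ * eM * (‖c₀‖ * BG) * (((n : ℝ) / Nat.totient n) * W n) +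
          ‖a n‖ * (BM + eM) * (eN * W n * ((n : ℝ) / Nat.totient n)) := add_le_add t1 t2
      _ = ‖a n‖ * ((n : ℝ) / Nat.totient n) * W n * ((BM + eM) * eN + eM * ‖c₀‖ * BG) := by ring
  have htot : (∑ n ∈ S, L n) - ∑ n ∈ S, R n = ∑ n ∈ S, (L n - R n) := by
    rw [Finset.sum_sub_distrib]
  rw [htot]
  refine (norm_sum_le _ _).trans ?_
  rw [Finset.sum_mul]
  exact Finset.sum_le_sum fun n hn => main_bound n hn

end Assembly

/-! ## The Euler-majorant weight -/

section Weights

/-- For `0 ≤ u ≤ 1`: `(1 + u)⁷ ≤ 1 + 127u` (each `uᵏ ≤ u`). [folklore] -/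
private theorem one_add_pow_seven_le {u : ℝ} (hu0 : 0 ≤ u) (hu1 : u ≤ 1) : (1 + u) ^ 7 ≤ 1 + 127 * u := by
  have h2 : u ^ 2 ≤ u := by nlinarith
  have h3 : u ^ 3 ≤ u := by nlinarith
  have h4 : u ^ 4 ≤ u := by nlinarith
  have h5 : u ^ 5 ≤ u := by nlinarith
  have h6 : u ^ 6 ≤ u := by nlinarith
  have h7 : u ^ 7 ≤ u := by nlinarith
  have e : (1 + u) ^ 7 = 1 + 7 * u + 21 * u ^ 2 + 35 * u ^ 3 + 35 * u ^ 4 + 21 * u ^ 5 +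
      7 * u ^ 6 + u ^ 7 := by ring
  rw [e]; linarith

/-- Per-prime bound behind the Euler-majorant weight: for a prime `q` (indeed any real `q ≥ 2`) and `A ≥ 0`,
`(q/(q−1))⁷·(1 + A/q) ≤ 1 + (254 + 128A)/q`. [folklore] -/
private theorem ratio_pow_seven_mul_le {q A : ℝ} (hq : 2 ≤ q) (hA : 0 ≤ A) :
    (q / (q - 1)) ^ 7 * (1 + A / q) ≤ 1 + (254 + 128 * A) / q := by
  have hq0 : 0 < q := by linarith
  have hq1 : 0 < q - 1 := by linarith
  have hratio : q / (q - 1) ≤ 1 + 2 / q := by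
    rw [div_le_iff₀ hq1]
    have : (1 + 2 / q) * (q - 1) = q + 1 - 2 / q := by field_simp; ring
    rw [this]
    have : 2 / q ≤ 1 := by rw [div_le_one hq0]; exact hq
    linarith
  have hratio0 : 0 ≤ q / (q - 1) := by positivity
  have hu0 : 0 ≤ 2 / q := by positivity
  have hu1 : 2 / q ≤ 1 := by rw [div_le_one hq0]; exact hq
  have h7 : (q / (q - 1)) ^ 7 ≤ 1 + 254 / q := by
    calc (q / (q - 1)) ^ 7 ≤ (1 + 2 / q) ^ 7 := pow_le_pow_left₀ hratio0 hratio 7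
      _ ≤ 1 + 127 * (2 / q) := one_add_pow_seven_le hu0 hu1
      _ = 1 + 254 / q := by ring
  have hA' : 0 ≤ 1 + A / q := by positivity
  calc (q / (q - 1)) ^ 7 * (1 + A / q) ≤ (1 + 254 / q) * (1 + A / q) :=
        mul_le_mul_of_nonneg_right h7 hA'
    _ = 1 + (254 + A) / q + 254 * A / q ^ 2 := by field_simp; ring
    _ ≤ 1 + (254 + A) / q + 127 * A / q := by
        have : 254 * A / q ^ 2 ≤ 127 * A / q := by
          rw [div_le_div_iff₀ (by positivity) hq0]
          have h2 : 0 ≤ q - 2 := by linarith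
          nlinarith [mul_nonneg (mul_nonneg hA hq0.le) h2]
        linarith
    _ = 1 + (254 + 128 * A) / q := by ring

/-- **The Euler-majorant weight is an Euler majorant**: for `n ≠ 0` and `A ≥ 0`,
`(n/φ(n))⁷·∏_{q∣n}(1 + A/q) ≤ ∏_{q∣n}(1 + (254 + 128A)/q)` (`n/φ(n) = ∏_{q∣n}q/(q−1)`,
`Skeleton.self_div_totient_eq_prod`, and `ratio_pow_seven_mul_le` per prime).
[cite: HallTenenbaum1988, §0.2] -/
theorem ratio_pow_seven_mul_prod_le {n : ℕ} (hn : n ≠ 0) {A : ℝ} (hA : 0 ≤ A) :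
    ((n : ℝ) / Nat.totient n) ^ 7 * ∏ q ∈ n.primeFactors, (1 + A / (q : ℝ)) ≤
      ∏ q ∈ n.primeFactors, (1 + (254 + 128 * A) / (q : ℝ)) := by
  rw [self_div_totient_eq_prod hn, ← Finset.prod_pow, ← Finset.prod_mul_distrib]
  refine Finset.prod_le_prod (fun q hq => ?_) fun q hq => ?_
  · have hq2 : (2 : ℝ) ≤ q := by exact_mod_cast (Nat.prime_of_mem_primeFactors hq).two_le
    have : 0 < (q : ℝ) - 1 := by linarith
    positivity
  · have hq2 : (2 : ℝ) ≤ q := by exact_mod_cast (Nat.prime_of_mem_primeFactors hq).two_le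
    exact ratio_pow_seven_mul_le hq2 hA

variable (c' : ℝ) {D : ℕ} (χ : DirichletCharacter ℂ D)

/-- **Weight of the main range in the Euler-majorant currency**: if every `n ∈ S′` satisfies `1 ≤ n ≤ Y`
(`1 ≤ Y`) and `A ≥ 0`, then `Σ_{n∈S′}‖a(n)‖(n/φ(n))³∏_{q∣n}(1 + A/q) ≤ e^{254+128A}(1 + log Y)`,
`a(n) = |χ(n)|λ₀ⱼ(n)/n` (`|λ₀ⱼ(n)| ≤ (n/φ(n))⁴`, `Ranges1422.norm_weight_mul_cube_le`;
`Sec18SjNorm.sum_prod_one_add_div_le`). [cite: Zhang2022LandauSiegel, §12 (12.12) p.71; §8 (8.10) p.47] -/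
theorem sum_weights_main_relA_le (j : ℕ) {S' : Finset ℕ} {Y A : ℝ} (hY : 1 ≤ Y) (hA : 0 ≤ A)
    (hS' : ∀ n ∈ S', 1 ≤ n ∧ (n : ℝ) ≤ Y) :
    ∑ n ∈ S', ‖(‖χ (n : ZMod D)‖ : ℂ) * lamZero c' D j n / (n : ℂ)‖ * ((n : ℝ) / Nat.totient n) ^ 3 *
        ∏ q ∈ n.primeFactors, (1 + A / (q : ℝ)) ≤
      Real.exp (254 + 128 * A) * (1 + Real.log Y) := by
  have hY0 : 0 < Y := by linarith
  have hsub : S' ⊆ Finset.Icc 1 ⌊Y⌋₊ := by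
    intro n hn
    obtain ⟨h1, h2⟩ := hS' n hn
    rw [Finset.mem_Icc]
    exact ⟨h1, Nat.le_floor h2⟩
  have hfl : 1 ≤ ⌊Y⌋₊ := Nat.le_floor (by exact_mod_cast hY)
  have hprod0 : ∀ n : ℕ, 0 ≤ ∏ q ∈ n.primeFactors, (1 + A / (q : ℝ)) := fun n =>
    Finset.prod_nonneg fun q _ => by positivity
  calc ∑ n ∈ S', ‖(‖χ (n : ZMod D)‖ : ℂ) * lamZero c' D j n / (n : ℂ)‖ * ((n : ℝ) / Nat.totient n) ^ 3 *
          ∏ q ∈ n.primeFactors, (1 + A / (q : ℝ))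
      ≤ ∑ n ∈ S', (∏ q ∈ n.primeFactors, (1 + (254 + 128 * A) / (q : ℝ))) / (n : ℝ) := by
        refine Finset.sum_le_sum fun n hn => ?_
        have hn0 : n ≠ 0 := by have := (hS' n hn).1; omega
        have hnpos : (0 : ℝ) < n := by exact_mod_cast Nat.pos_of_ne_zero hn0
        have h1 := norm_weight_mul_cube_le c' χ j hn0
        calc ‖(‖χ (n : ZMod D)‖ : ℂ) * lamZero c' D j n / (n : ℂ)‖ * ((n : ℝ) / Nat.totient n) ^ 3 *
              ∏ q ∈ n.primeFactors, (1 + A / (q : ℝ))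
            ≤ ((n : ℝ) / Nat.totient n) ^ 7 / n * ∏ q ∈ n.primeFactors, (1 + A / (q : ℝ)) :=
              mul_le_mul_of_nonneg_right h1 (hprod0 n)
          _ = (((n : ℝ) / Nat.totient n) ^ 7 * ∏ q ∈ n.primeFactors, (1 + A / (q : ℝ))) / n := by
              ring
          _ ≤ (∏ q ∈ n.primeFactors, (1 + (254 + 128 * A) / (q : ℝ))) / (n : ℝ) :=
              div_le_div_of_nonneg_right (ratio_pow_seven_mul_prod_le hn0 hA) hnpos.le
    _ ≤ ∑ n ∈ Finset.Icc 1 ⌊Y⌋₊, (∏ q ∈ n.primeFactors, (1 + (254 + 128 * A) / (q : ℝ))) / (n : ℝ) :=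
        Finset.sum_le_sum_of_subset_of_nonneg hsub fun n _ _ => by
          have : 0 ≤ ∏ q ∈ n.primeFactors, (1 + (254 + 128 * A) / (q : ℝ)) :=
            Finset.prod_nonneg fun q _ => by positivity
          positivity
    _ ≤ Real.exp (254 + 128 * A) * (1 + Real.log (⌊Y⌋₊ : ℕ)) :=
        Sec18SjNorm.sum_prod_one_add_div_le (by positivity) ⌊Y⌋₊
    _ ≤ Real.exp (254 + 128 * A) * (1 + Real.log Y) := by
        have hlog : Real.log (⌊Y⌋₊ : ℕ) ≤ Real.log Y :=
          Real.log_le_log (by exact_mod_cast hfl) (Nat.floor_le hY0.le)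
        have := Real.exp_pos (254 + 128 * A)
        nlinarith

end Weights

/-! ## The core estimate at a fixed modulus, (12.10) in the Euler-majorant currency -/

section Core

variable (c' : ℝ)

set_option maxHeartbeats 1600000 in
/-- **(12.12), first equality, at a fixed modulus, from (12.10) in the EULER-MAJORANT currency.** For every
`c′` and constants `C₉, C₁₀, A ≥ 0` there is `K` such that: if `D` (with `𝓛 ≥ 5`, `5|c′|α𝓛 ≤ 1`,
`4Dt₀² ≤ T`), a real primitive `χ (mod D)` and `j` satisfy Lemma 8.2's two evaluations (`μ = 6` at `P₃/dr`,
`μ = 7` at `P₂/dr`) with rate `C₉𝓛⁻¹⁵`, and (12.10) with the error `C₁₀𝓛⁻¹⁵·∏_{q∣dr}(1 + A/q)` on the closed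
range `dr ≤ P″₁/T`, then for `𝐚₂₅ = conj(χϰ₁₃)`: `‖S_j(𝐚₁₂,𝐚₂₅)|_{dr≤P″₁/T} − main1212sum‖ ≤ K𝓛⁻¹²`.
(Twin of zl-w12-p10's `eq1212_first_core`; the factor `∏_{q∣n}(1 + A/q)`, `n = dr`, is absorbed by the weight
`|χ(n)|λ₀ⱼ(n)n⁻¹(n/φ(n))³`, `range_assembly_bound_weighted` + `sum_weights_main_relA_le`.)
[cite: Zhang2022LandauSiegel, §12 (12.12) p.71, tex L3605–L3612] -/
theorem eq1212_first_core_relA {C₉ C₁₀ A : ℝ} (hC₉ : 0 ≤ C₉) (hC₁₀ : 0 ≤ C₁₀) (hA : 0 ≤ A) :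
    ∃ K : ℝ, 0 ≤ K ∧ ∀ {D : ℕ} [NeZero D] {χ : DirichletCharacter ℂ D}, χ.IsQuadratic →
      χ.IsPrimitive → 5 ≤ ell D → 5 * |c'| * alpha D * ell D ≤ 1 → 4 * (D : ℝ) * t0 D ^ 2 ≤ bigT D →
      ∀ j : ℕ,
      (∀ d r : ℕ, 1 ≤ d → 1 ≤ r → ((d * r : ℕ) : ℝ) < Skeleton.P3 D / bigT D →
        ‖(∑ m ∈ Finset.Ico 1 (Nsupp D),
              χ (m : ZMod D) * vk3 D (d * r * m) / (m : ℂ) ^ (1 - betaJ c' D j)) -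
            deriv χ.LFunction 1 / (Real.log (Skeleton.P3 D) : ℂ) *
              frakfW c' D j 6 (Skeleton.P3 D / ((d * r : ℕ) : ℝ))‖ ≤ C₉ * (ell D ^ 15)⁻¹) →
      (∀ d r : ℕ, 1 ≤ d → 1 ≤ r → ((d * r : ℕ) : ℝ) < Skeleton.P2 D / bigT D →
        ‖(∑ m ∈ Finset.Ico 1 (Nsupp D),
              χ (m : ZMod D) * vk2 D (d * r * m) / (m : ℂ) ^ (1 - betaJ c' D j)) -
            deriv χ.LFunction 1 / (Real.log (Skeleton.P2 D) : ℂ) *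
              frakfW c' D j 7 (Skeleton.P2 D / ((d * r : ℕ) : ℝ))‖ ≤ C₉ * (ell D ^ 15)⁻¹) →
      (∀ d r : ℕ, 1 ≤ d → 1 ≤ r → ((d * r : ℕ) : ℝ) ≤ P1pp D / bigT D →
        ‖Sec12B.sum122 c' χ j d r - Sec12B.main1210 c' χ j d r‖ ≤
          C₁₀ * (ell D ^ 15)⁻¹ * ∏ q ∈ (d * r).primeFactors, (1 + A / (q : ℝ))) →
      ∀ a25 : ℕ → ℂ, (∀ n, a25 n = conj (χ (n : ZMod D) * vk13 D n)) →
        ‖SjOn c' D j (a12 χ) a25 (rngLow D) - main1212sum c' χ j‖ ≤ K * (ell D ^ 12)⁻¹ := by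
  classical
  -- the constants
  set fpr : ℝ := 29 * (1.25 / 0.498 + 2.3 / 0.5) with hfpr
  set a₀ : ℝ := 4 * Real.exp (9 / 2) * fpr with ha₀
  set m₀ : ℝ := 3.55 * C₉ + 4 * Real.exp (9 / 2) * 25000 with hm₀
  set c₀₀ : ℝ := ‖bstar‖ * (4 * Real.exp (9 / 2)) * (9 * π * (1 + 5 * |c'| * π) ^ 2) * π with hc₀₀
  set k₀ : ℝ := 4 * Real.exp (9 / 2) * c₀₀ with hk₀
  set eB : ℝ := Real.exp (254 + 128 * A) with heB
  set K : ℝ := 2 * eB * ((a₀ + m₀) * C₁₀ + m₀ * c₀₀) + 4 * Real.exp 256 * k₀ * fpr with hK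
  have hfpr0 : 0 ≤ fpr := by rw [hfpr]; norm_num
  have ha₀0 : 0 ≤ a₀ := by rw [ha₀]; positivity
  have hm₀0 : 0 ≤ m₀ := by rw [hm₀]; positivity
  have hc₀₀0 : 0 ≤ c₀₀ := by rw [hc₀₀]; positivity
  have hk₀0 : 0 ≤ k₀ := by rw [hk₀]; positivity
  have heB0 : 0 < eB := Real.exp_pos _
  refine ⟨K, by rw [hK]; positivity, ?_⟩
  intro D _ χ hq hp hℓ5 hc5 hT4 j hM3 hM2 h10 a25 ha25
  -- scales
  obtain ⟨hY2, hYP1pp, hP1ppP, hP1P3, hP1P2, h4YX, hXP2, hP2PT⟩ := scales12 hℓ5 hT4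
  set L : ℝ := ell D with hLdef
  set Y : ℝ := P1pp D / bigT D with hYdef
  set X : ℝ := bigP D ^ (0.496 : ℝ) with hXdef
  have hℓ3 : 3 ≤ ell D := by linarith
  have hL1 : 1 ≤ L := by rw [hLdef]; linarith
  have hL0 : 0 < L := by linarith
  have hD3 : 3 ≤ Real.log D := by simpa only [ell] using hℓ3
  have hD1 : 1 ≤ Real.log D := by linarith
  obtain ⟨hα, hαeq, hαℓ⟩ := alpha_facts (D := D) hℓ3
  have hlogP : Real.log (bigP D) = L ^ 9 := by rw [hLdef, log_bigP]
  have hlogP0 : 0 < Real.log (bigP D) := by rw [hlogP]; positivity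
  have hT0 : 0 < bigT D := Real.exp_pos _
  have hY1 : 1 ≤ Y := by linarith
  have hY0 : 0 < Y := by linarith
  have hYX : Y ≤ X := by linarith
  have hYP3T : Y < Skeleton.P3 D / bigT D := div_lt_div_of_pos_right hP1P3 hT0
  have hYP2T : Y < Skeleton.P2 D / bigT D := div_lt_div_of_pos_right hP1P2 hT0
  have hP1 : 1 ≤ bigP D := Sec10C.one_le_bigP D
  have hX498 : X ≤ bigP D ^ (0.498 : ℝ) := Real.rpow_le_rpow_of_exponent_le hP1 (by norm_num)
  have hX5 : X ≤ bigP D ^ (0.5 : ℝ) := Real.rpow_le_rpow_of_exponent_le hP1 (by norm_num)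
  have hXPT : X ≤ bigP D / bigT D ^ 2 := hXP2.trans hP2PT
  have hceilX : ⌈X⌉₊ ≤ Nsupp D := Nat.ceil_mono hXPT
  -- sizes of `L′`, `c₀`, `K₁₂`
  have hL' : ‖deriv χ.LFunction 1‖ ≤ 4 * Real.exp (9 / 2) * L ^ 2 := norm_deriv_L_one_le χ hℓ3 hp
  set c₀ : ℂ := bstar * deriv χ.LFunction 1 * (Real.log (bigP D) : ℂ) *
    betaJ c' D (j + 1) * betaJ c' D (j + 2) with hc₀def
  have hββ := Sec12D.norm_betaJ_mul_betaJ_mul_logP_le c' (D := D) hD1 (j + 1) (j + 2)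
  have hc₀ : ‖c₀‖ ≤ c₀₀ * (L ^ 7)⁻¹ := by
    have e : ‖c₀‖ = ‖bstar‖ * ‖deriv χ.LFunction 1‖ *
        (‖betaJ c' D (j + 1) * betaJ c' D (j + 2)‖ * Real.log (bigP D)) := by
      rw [hc₀def, norm_mul, norm_mul, norm_mul, norm_mul, Complex.norm_real,
        Real.norm_of_nonneg hlogP0.le, norm_mul]
      ring
    rw [e]
    calc ‖bstar‖ * ‖deriv χ.LFunction 1‖ * (‖betaJ c' D (j + 1) * betaJ c' D (j + 2)‖ * Real.log (bigP D))
        ≤ ‖bstar‖ * (4 * Real.exp (9 / 2) * L ^ 2) * (9 * π * (1 + 5 * |c'| * π) ^ 2 * alpha D) := by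
          gcongr
      _ = c₀₀ * (L ^ 7)⁻¹ := by
          rw [hc₀₀, hαeq, ← hLdef]; field_simp
  -- the objects of the assembly
  set S : Finset ℕ := (Finset.Ico 1 (Nsupp D)).filter (fun n => rngLow D n) with hSdef
  set a : ℕ → ℂ := fun n => (‖χ (n : ZMod D)‖ : ℂ) * lamZero c' D j n / (n : ℂ) with hadef
  set M₃ : ℕ → ℂ := fun n => ∑ m ∈ Finset.Ico 1 (Nsupp D),
    χ (m : ZMod D) * vk3 D (n * m) / (m : ℂ) ^ (1 - betaJ c' D j) with hM₃def
  set M₂ : ℕ → ℂ := fun n => ∑ m ∈ Finset.Ico 1 (Nsupp D),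
    χ (m : ZMod D) * vk2 D (n * m) / (m : ℂ) ^ (1 - betaJ c' D j) with hM₂def
  set M : ℕ → ℂ := fun n => conj iota3 * M₃ n + conj iota4 * M₂ n with hMdef
  set Fpr : ℕ → ℂ := fun n => conj iota3 * frakfW c' D j 6 (bigP D ^ (0.498 : ℝ) / n) / 0.498 +
    conj iota4 * frakfW c' D j 7 (bigP D ^ (0.5 : ℝ) / n) / 0.5 with hFprdef
  set A₀ : ℕ → ℂ := fun n => deriv χ.LFunction 1 * Fpr n / (Real.log (bigP D) : ℂ) with hAdef
  set N : ℕ → ℕ → ℂ := fun d r => Sec12B.sum122 c' χ j d r with hNdef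
  set Pw : ℕ → ℕ → ℂ := fun d r => PiW χ d r with hPwdef
  set G : ℕ → ℂ := fun _ => 1 with hGdef
  set W : ℕ → ℝ := fun n => ((n : ℝ) / Nat.totient n) ^ 2 *
    ∏ q ∈ n.primeFactors, (1 + A / (q : ℝ)) with hWdef
  -- membership in `S`
  have hSmem : ∀ n ∈ S, 1 ≤ n ∧ (n : ℝ) ≤ Y := by
    intro n hn
    rw [hSdef, Finset.mem_filter, Finset.mem_Ico] at hn
    exact ⟨hn.1.1, hn.2⟩
  have hS0 : ∀ n ∈ S, n ≠ 0 := fun n hn => by have := (hSmem n hn).1; omega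
  have hRlt : ∀ n : ℕ, rngLow D n → n < Nsupp D := by
    intro n hn
    have h : (n : ℝ) < bigP D / bigT D ^ 2 := lt_of_le_of_lt hn (by linarith)
    exact Nat.lt_ceil.mpr h
  -- the weight `W(n) = (n/φ(n))²∏_{q∣n}(1 + A/q) ≥ 1`
  have hprod1 : ∀ n : ℕ, 1 ≤ ∏ q ∈ n.primeFactors, (1 + A / (q : ℝ)) := fun n =>
    Sec12B.one_le_prod_one_add_div n hA
  have hW1 : ∀ n ∈ S, 1 ≤ W n := fun n hn =>
    one_le_mul_of_one_le_of_one_le (one_le_pow₀ (one_le_self_div_totient (hS0 n hn))) (hprod1 n)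
  -- Step A: the re-indexed `S_j`
  have hSj : SjOn c' D j (a12 χ) a25 (rngLow D) =
      ∑ n ∈ S, ∑ r ∈ n.divisors,
        (if Squarefree r then a n / (Nat.totient r : ℂ) * M n * N (n / r) r else 0) := by
    rw [SjOn_a12_a25_eq_divisor_sum c' χ hq hD3 j ha25 (rngLow D) hRlt]
    try rfl
  -- Step B: pointwise inputs of the assembly
  have hPi : ∀ n ∈ S,
      ∑ r ∈ n.divisors with Squarefree r, (1 / (Nat.totient r : ℂ)) * Pw (n / r) r =
        (n : ℂ) / (Nat.totient n : ℂ) :=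
    fun n hn => Section8FrontEnd810.eq810_holds D χ hq n (hS0 n hn)
  -- `M(n) = A(n) + O(𝓛⁻¹⁴)` for all `n ∈ S`
  have hMA : ∀ n ∈ S, ‖M n - A₀ n‖ ≤ m₀ * (L ^ 14)⁻¹ := by
    intro n hn
    obtain ⟨hn1, hnY⟩ := hSmem n hn
    have hn1R : (1 : ℝ) ≤ n := by exact_mod_cast hn1
    have hnP3 : ((n * 1 : ℕ) : ℝ) < Skeleton.P3 D / bigT D := by
      rw [Nat.mul_one]; exact lt_of_le_of_lt hnY hYP3T
    have hnP2 : ((n * 1 : ℕ) : ℝ) < Skeleton.P2 D / bigT D := by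
      rw [Nat.mul_one]; exact lt_of_le_of_lt hnY hYP2T
    have e3 := hM3 n 1 hn1 le_rfl hnP3
    have e2 := hM2 n 1 hn1 le_rfl hnP2
    simp only [Nat.mul_one] at e3 e2
    have hbr := norm_F_sub_Fpr_le c' (D := D) hℓ3 hc5 j hn1R (hnY.trans (hYX.trans hX5))
    have hi3 : ‖conj iota3‖ ≤ 1.25 := by rw [Complex.norm_conj]; exact Sec10C.norm_iota34_le.1
    have hi4 : ‖conj iota4‖ ≤ 2.3 := by rw [Complex.norm_conj]; exact Sec10C.norm_iota34_le.2
    have hlogP_ne : (Real.log (bigP D) : ℂ) ≠ 0 := by exact_mod_cast hlogP0.ne'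
    have hid : M n - A₀ n =
        conj iota3 * (M₃ n - deriv χ.LFunction 1 / (Real.log (Skeleton.P3 D) : ℂ) *
            frakfW c' D j 6 (Skeleton.P3 D / (n : ℝ))) +
          conj iota4 * (M₂ n - deriv χ.LFunction 1 / (Real.log (Skeleton.P2 D) : ℂ) *
            frakfW c' D j 7 (Skeleton.P2 D / (n : ℝ))) +
          deriv χ.LFunction 1 *
            ((conj iota3 * (Real.log (Skeleton.P3 D) : ℂ)⁻¹ * frakfW c' D j 6 (Skeleton.P3 D / n) +
                conj iota4 * (Real.log (Skeleton.P2 D) : ℂ)⁻¹ * frakfW c' D j 7 (Skeleton.P2 D / n)) -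
              (conj iota3 * frakfW c' D j 6 (bigP D ^ (0.498 : ℝ) / n) / 0.498 +
                conj iota4 * frakfW c' D j 7 (bigP D ^ (0.5 : ℝ) / n) / 0.5) /
                (Real.log (bigP D) : ℂ)) := by
      have eM : M n = conj iota3 * M₃ n + conj iota4 * M₂ n := rfl
      have eA : A₀ n = deriv χ.LFunction 1 * Fpr n / (Real.log (bigP D) : ℂ) := rfl
      have eF : Fpr n = conj iota3 * frakfW c' D j 6 (bigP D ^ (0.498 : ℝ) / n) / 0.498 +
          conj iota4 * frakfW c' D j 7 (bigP D ^ (0.5 : ℝ) / n) / 0.5 := rfl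
      have hl3 : (Real.log (Skeleton.P3 D) : ℂ) ≠ 0 := by
        rw [log_P3_eq, ← hLdef]; exact_mod_cast (by positivity : (0.498 : ℝ) * L ^ 9 ≠ 0)
      have hl2 : (Real.log (Skeleton.P2 D) : ℂ) ≠ 0 := by exact_mod_cast (log_P2_pos hℓ3).ne'
      rw [eM, eA, eF]
      field_simp; ring
    rw [hid]
    have h11L : L ^ (1.1 : ℝ) ≤ L ^ 2 := by
      have h : L ^ (1.1 : ℝ) ≤ L ^ (2 : ℝ) := Real.rpow_le_rpow_of_exponent_le hL1 (by norm_num)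
      simpa using h
    have hL15 : (L ^ 15)⁻¹ ≤ (L ^ 14)⁻¹ :=
      inv_anti₀ (by positivity) (pow_le_pow_right₀ hL1 (by norm_num))
    calc ‖conj iota3 * (M₃ n - deriv χ.LFunction 1 / (Real.log (Skeleton.P3 D) : ℂ) *
            frakfW c' D j 6 (Skeleton.P3 D / (n : ℝ))) +
          conj iota4 * (M₂ n - deriv χ.LFunction 1 / (Real.log (Skeleton.P2 D) : ℂ) *
            frakfW c' D j 7 (Skeleton.P2 D / (n : ℝ))) +
          deriv χ.LFunction 1 *
            ((conj iota3 * (Real.log (Skeleton.P3 D) : ℂ)⁻¹ * frakfW c' D j 6 (Skeleton.P3 D / n) +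
                conj iota4 * (Real.log (Skeleton.P2 D) : ℂ)⁻¹ * frakfW c' D j 7 (Skeleton.P2 D / n)) -
              (conj iota3 * frakfW c' D j 6 (bigP D ^ (0.498 : ℝ) / n) / 0.498 +
                conj iota4 * frakfW c' D j 7 (bigP D ^ (0.5 : ℝ) / n) / 0.5) /
                (Real.log (bigP D) : ℂ))‖
        ≤ ‖conj iota3‖ * ‖M₃ n - deriv χ.LFunction 1 / (Real.log (Skeleton.P3 D) : ℂ) *
            frakfW c' D j 6 (Skeleton.P3 D / (n : ℝ))‖ +
          ‖conj iota4‖ * ‖M₂ n - deriv χ.LFunction 1 / (Real.log (Skeleton.P2 D) : ℂ) *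
            frakfW c' D j 7 (Skeleton.P2 D / (n : ℝ))‖ +
          ‖deriv χ.LFunction 1‖ *
            ‖(conj iota3 * (Real.log (Skeleton.P3 D) : ℂ)⁻¹ * frakfW c' D j 6 (Skeleton.P3 D / n) +
                conj iota4 * (Real.log (Skeleton.P2 D) : ℂ)⁻¹ * frakfW c' D j 7 (Skeleton.P2 D / n)) -
              (conj iota3 * frakfW c' D j 6 (bigP D ^ (0.498 : ℝ) / n) / 0.498 +
                conj iota4 * frakfW c' D j 7 (bigP D ^ (0.5 : ℝ) / n) / 0.5) /
                (Real.log (bigP D) : ℂ)‖ := by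
          refine (norm_add_le _ _).trans (add_le_add ((norm_add_le _ _).trans (add_le_add ?_ ?_)) ?_)
          · rw [norm_mul]
          · rw [norm_mul]
          · rw [norm_mul]
      _ ≤ 1.25 * (C₉ * (L ^ 15)⁻¹) + 2.3 * (C₉ * (L ^ 15)⁻¹) +
          (4 * Real.exp (9 / 2) * L ^ 2) * (25000 * L ^ (1.1 : ℝ) * (L ^ 18)⁻¹) := by
          gcongr
      _ ≤ 1.25 * (C₉ * (L ^ 14)⁻¹) + 2.3 * (C₉ * (L ^ 14)⁻¹) +
          (4 * Real.exp (9 / 2) * L ^ 2) * (25000 * L ^ 2 * (L ^ 18)⁻¹) := by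
          gcongr
      _ = m₀ * (L ^ 14)⁻¹ := by rw [hm₀]; field_simp; ring
  -- `‖A(n)‖ ≤ a₀𝓛⁻⁷` for all `n ∈ S`
  have hAn : ∀ n ∈ S, ‖A₀ n‖ ≤ a₀ * (L ^ 7)⁻¹ := by
    intro n hn
    obtain ⟨hn1, hnY⟩ := hSmem n hn
    have hn1R : (1 : ℝ) ≤ n := by exact_mod_cast hn1
    have hF := norm_Fpr_le c' (D := D) hℓ3 hc5 j hn1R (hnY.trans (hYX.trans hX498))
    simp only [hAdef]
    rw [norm_div, norm_mul, Complex.norm_real, Real.norm_of_nonneg hlogP0.le, hlogP]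
    rw [div_le_iff₀ (by positivity)]
    calc ‖deriv χ.LFunction 1‖ * ‖Fpr n‖ ≤ (4 * Real.exp (9 / 2) * L ^ 2) * fpr :=
          mul_le_mul hL' hF (norm_nonneg _) (by positivity)
      _ = a₀ * (L ^ 7)⁻¹ * L ^ 9 := by rw [ha₀]; field_simp
  -- (12.10) in the Euler-majorant currency on all of `n ≤ Y`, error `≤ C₁₀𝓛⁻¹⁵·W(n)`
  have hNmain : ∀ n ∈ S, ∀ r ∈ n.divisors, Squarefree r →
      ‖N (n / r) r - c₀ * Pw (n / r) r * G n‖ ≤ C₁₀ * (L ^ 15)⁻¹ * W n := by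
    intro n hn r hr _
    have hn0 := hS0 n hn
    have hnY := (hSmem n hn).2
    have hrd : r ∣ n := Nat.dvd_of_mem_divisors hr
    have hr0 : r ≠ 0 := Nat.pos_iff_ne_zero.mp (Nat.pos_of_mem_divisors hr)
    have hdr : n / r * r = n := Nat.div_mul_cancel hrd
    have hd1 : 1 ≤ n / r := Nat.div_pos (Nat.le_of_dvd (Nat.pos_of_ne_zero hn0) hrd)
      (Nat.pos_of_ne_zero hr0)
    have hle : ((n / r * r : ℕ) : ℝ) ≤ P1pp D / bigT D := by rw [hdr]; exact hnY
    have key := h10 (n / r) r hd1 (Nat.one_le_iff_ne_zero.mpr hr0) hle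
    rw [hdr] at key
    have e : Sec12B.main1210 c' χ j (n / r) r = c₀ * Pw (n / r) r * G n := by
      simp only [Sec12B.main1210, hc₀def, hPwdef, hGdef]; ring
    have hWge : ∏ q ∈ n.primeFactors, (1 + A / (q : ℝ)) ≤ W n :=
      le_mul_of_one_le_left (zero_le_one.trans (hprod1 n))
        (one_le_pow₀ (one_le_self_div_totient hn0))
    have hC15 : 0 ≤ C₁₀ * (L ^ 15)⁻¹ := by positivity
    simp only [hNdef]
    rw [← e, hLdef]
    exact key.trans (by rw [← hLdef]; exact mul_le_mul_of_nonneg_left hWge hC15)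
  -- Step C: the weighted assembly
  have hassembly := range_assembly_bound_weighted (S := S) hS0 a M A₀ G N Pw c₀ W
    (eM := m₀ * (L ^ 14)⁻¹) (BM := a₀ * (L ^ 7)⁻¹) (BG := 1) (eN := C₁₀ * (L ^ 15)⁻¹)
    (by positivity) (by positivity) hW1 hPi hMA hAn (fun n _ => by simp [hGdef]) hNmain
  -- the weight
  have hW₁ : ∑ n ∈ S, ‖a n‖ * ((n : ℝ) / Nat.totient n) * W n ≤ eB * (1 + Real.log Y) := by
    have e : ∑ n ∈ S, ‖a n‖ * ((n : ℝ) / Nat.totient n) * W n =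
        ∑ n ∈ S, ‖a n‖ * ((n : ℝ) / Nat.totient n) ^ 3 * ∏ q ∈ n.primeFactors, (1 + A / (q : ℝ)) :=
      Finset.sum_congr rfl fun n _ => by simp only [hWdef]; ring
    rw [e, heB]
    exact sum_weights_main_relA_le c' χ j hY1 hA hSmem
  -- Step D: the printed main term, split at `Y`
  have hmainS : ∑ n ∈ S, a n * ((n : ℂ) / (Nat.totient n : ℂ)) * (A₀ n * c₀ * G n) =
      deriv χ.LFunction 1 ^ 2 * bstar * (betaJ c' D (j + 1) * betaJ c' D (j + 2)) *
        ∑ n ∈ S, (‖χ (n : ZMod D)‖ : ℂ) * lamZero c' D j n / (Nat.totient n : ℂ) * Fpr n := by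
    rw [Finset.mul_sum]
    refine Finset.sum_congr rfl fun n hn => ?_
    have hn0 : (n : ℂ) ≠ 0 := by exact_mod_cast hS0 n hn
    have hφ : (Nat.totient n : ℂ) ≠ 0 := by
      exact_mod_cast (Nat.totient_pos.mpr (Nat.pos_of_ne_zero (hS0 n hn))).ne'
    have hlP : (Real.log (bigP D) : ℂ) ≠ 0 := by exact_mod_cast hlogP0.ne'
    have ea : a n = (‖χ (n : ZMod D)‖ : ℂ) * lamZero c' D j n / (n : ℂ) := rfl
    have eA : A₀ n = deriv χ.LFunction 1 * Fpr n / (Real.log (bigP D) : ℂ) := rfl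
    have eG : G n = 1 := rfl
    rw [ea, eA, eG, hc₀def]
    field_simp
  have hSX : (Finset.Ico 1 ⌈X⌉₊).filter (fun n => rngLow D n) = S := by
    ext n
    simp only [hSdef, Finset.mem_filter, Finset.mem_Ico]
    constructor
    · rintro ⟨⟨h1, h2⟩, h3⟩
      exact ⟨⟨h1, lt_of_lt_of_le h2 hceilX⟩, h3⟩
    · rintro ⟨⟨h1, -⟩, h3⟩
      refine ⟨⟨h1, ?_⟩, h3⟩
      have : (n : ℝ) < X := lt_of_le_of_lt h3 (by linarith)
      exact Nat.lt_ceil.mpr this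
  have hmain_split : main1212sum c' χ j =
      deriv χ.LFunction 1 ^ 2 * bstar * (betaJ c' D (j + 1) * betaJ c' D (j + 2)) *
        ∑ n ∈ S, (‖χ (n : ZMod D)‖ : ℂ) * lamZero c' D j n / (Nat.totient n : ℂ) * Fpr n +
      deriv χ.LFunction 1 ^ 2 * bstar * (betaJ c' D (j + 1) * betaJ c' D (j + 2)) *
        ∑ n ∈ (Finset.Ico 1 ⌈X⌉₊).filter (fun n => ¬ rngLow D n),
          (‖χ (n : ZMod D)‖ : ℂ) * lamZero c' D j n / (Nat.totient n : ℂ) * Fpr n := by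
    rw [main1212sum_eq_sum, ← mul_add, ← hSX, Finset.sum_filter_add_sum_filter_not]
  -- the window `Y < n < X` of the printed main term
  set K₁₂ : ℂ := deriv χ.LFunction 1 ^ 2 * bstar * (betaJ c' D (j + 1) * betaJ c' D (j + 2)) with hK₁₂
  have hK₁₂n : ‖K₁₂‖ ≤ k₀ * (L ^ 14)⁻¹ := by
    have e : ‖K₁₂‖ = ‖deriv χ.LFunction 1‖ * (‖bstar‖ * ‖deriv χ.LFunction 1‖ *
        (‖betaJ c' D (j + 1) * betaJ c' D (j + 2)‖ * Real.log (bigP D))) / Real.log (bigP D) := by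
      rw [hK₁₂, norm_mul, norm_mul, norm_pow]
      field_simp
    have hc₀' : ‖bstar‖ * ‖deriv χ.LFunction 1‖ *
        (‖betaJ c' D (j + 1) * betaJ c' D (j + 2)‖ * Real.log (bigP D)) ≤ c₀₀ * (L ^ 7)⁻¹ := by
      calc ‖bstar‖ * ‖deriv χ.LFunction 1‖ * (‖betaJ c' D (j + 1) * betaJ c' D (j + 2)‖ * Real.log (bigP D))
          ≤ ‖bstar‖ * (4 * Real.exp (9 / 2) * L ^ 2) * (9 * π * (1 + 5 * |c'| * π) ^ 2 * alpha D) := by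
            gcongr
        _ = c₀₀ * (L ^ 7)⁻¹ := by rw [hc₀₀, hαeq, ← hLdef]; field_simp
    rw [e, div_le_iff₀ hlogP0]
    have hc₀'0 : 0 ≤ ‖bstar‖ * ‖deriv χ.LFunction 1‖ *
        (‖betaJ c' D (j + 1) * betaJ c' D (j + 2)‖ * Real.log (bigP D)) :=
      mul_nonneg (mul_nonneg (norm_nonneg _) (norm_nonneg _)) (mul_nonneg (norm_nonneg _) hlogP0.le)
    have h4pos : 0 ≤ 4 * Real.exp (9 / 2) * L ^ 2 := by positivity
    calc ‖deriv χ.LFunction 1‖ * (‖bstar‖ * ‖deriv χ.LFunction 1‖ *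
          (‖betaJ c' D (j + 1) * betaJ c' D (j + 2)‖ * Real.log (bigP D)))
        ≤ (4 * Real.exp (9 / 2) * L ^ 2) * (c₀₀ * (L ^ 7)⁻¹) :=
          mul_le_mul hL' hc₀' hc₀'0 h4pos
      _ = k₀ * (L ^ 14)⁻¹ * L ^ 9 := by rw [hk₀]; field_simp
      _ = k₀ * (L ^ 14)⁻¹ * Real.log (bigP D) := by rw [hlogP]
  have hwindow : ‖∑ n ∈ (Finset.Ico 1 ⌈X⌉₊).filter (fun n => ¬ rngLow D n),
      (‖χ (n : ZMod D)‖ : ℂ) * lamZero c' D j n / (Nat.totient n : ℂ) * Fpr n‖ ≤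
      fpr * (Real.exp 256 * (3 + Real.log X - Real.log Y)) := by
    have hmem : ∀ n ∈ (Finset.Ico 1 ⌈X⌉₊).filter (fun n => ¬ rngLow D n),
        1 ≤ n ∧ Y ≤ (n : ℝ) ∧ (n : ℝ) ≤ X := by
      intro n hn
      rw [Finset.mem_filter, Finset.mem_Ico] at hn
      refine ⟨hn.1.1, le_of_lt (not_le.mp hn.2), le_of_lt (Nat.lt_ceil.mp hn.1.2)⟩
    calc ‖∑ n ∈ (Finset.Ico 1 ⌈X⌉₊).filter (fun n => ¬ rngLow D n),
          (‖χ (n : ZMod D)‖ : ℂ) * lamZero c' D j n / (Nat.totient n : ℂ) * Fpr n‖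
        ≤ ∑ n ∈ (Finset.Ico 1 ⌈X⌉₊).filter (fun n => ¬ rngLow D n),
          ‖(‖χ (n : ZMod D)‖ : ℂ) * lamZero c' D j n / (Nat.totient n : ℂ) * Fpr n‖ := norm_sum_le _ _
      _ ≤ ∑ n ∈ (Finset.Ico 1 ⌈X⌉₊).filter (fun n => ¬ rngLow D n),
          ‖a n‖ * ((n : ℝ) / Nat.totient n) ^ 3 * fpr := by
          refine Finset.sum_le_sum fun n hn => ?_
          obtain ⟨hn1, hnY, hnX⟩ := hmem n hn
          have hn0 : n ≠ 0 := by omega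
          have hn0R : (n : ℝ) ≠ 0 := by exact_mod_cast hn0
          have hφ0 : (0 : ℝ) < Nat.totient n := by exact_mod_cast Nat.totient_pos.mpr (by omega)
          have hF := norm_Fpr_le c' (D := D) hℓ3 hc5 j (by exact_mod_cast hn1) (hnX.trans hX498)
          have hrat1 := one_le_self_div_totient hn0
          have e : ‖(‖χ (n : ZMod D)‖ : ℂ) * lamZero c' D j n / (Nat.totient n : ℂ) * Fpr n‖ =
              ‖a n‖ * ((n : ℝ) / Nat.totient n) * ‖Fpr n‖ := by
            simp only [hadef]
            rw [norm_mul, norm_div, norm_div, norm_mul, Complex.norm_natCast, Complex.norm_natCast]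
            field_simp
          rw [e]
          have h3 : (n : ℝ) / Nat.totient n ≤ ((n : ℝ) / Nat.totient n) ^ 3 := by
            calc (n : ℝ) / Nat.totient n = ((n : ℝ) / Nat.totient n) ^ 1 := (pow_one _).symm
              _ ≤ ((n : ℝ) / Nat.totient n) ^ 3 := pow_le_pow_right₀ hrat1 (by norm_num)
          gcongr
      _ = (∑ n ∈ (Finset.Ico 1 ⌈X⌉₊).filter (fun n => ¬ rngLow D n),
          ‖a n‖ * ((n : ℝ) / Nat.totient n) ^ 3) * fpr := by rw [Finset.sum_mul]
      _ ≤ (Real.exp 256 * (3 + Real.log X - Real.log Y)) * fpr := by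
          gcongr
          exact sum_weights_le c' χ j hY2 hYX fun n hn => (hmem n hn).2
      _ = fpr * (Real.exp 256 * (3 + Real.log X - Real.log Y)) := by ring
  -- logarithms of the scales
  have hlogY : Real.log Y ≤ L ^ 9 := by
    rw [← hlogP]
    exact Real.log_le_log hY0 (hYP1pp.trans hP1ppP)
  have hlogY0 : 0 ≤ Real.log Y := Real.log_nonneg hY1
  have hlogXY : Real.log X - Real.log Y ≤ L ^ 2 := by
    -- `X/Y = T/(Dt₀) ≤ T`, `log T = 𝓛^{1.1} ≤ 𝓛²`
    have hDt1 := Dt0_ge_one (D := D) hℓ3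
    have hDt0 := Dt0_pos (D := D) hℓ3
    have hXY : X / Y = bigT D / ((D : ℝ) * t0 D) := by
      rw [hXdef, hYdef, P1pp]
      field_simp
    have hXYT : X / Y ≤ bigT D := by
      rw [hXY]; exact div_le_self hT0.le hDt1
    have h11 : L ^ (1.1 : ℝ) ≤ L ^ 2 := by
      have h : L ^ (1.1 : ℝ) ≤ L ^ (2 : ℝ) := Real.rpow_le_rpow_of_exponent_le hL1 (by norm_num)
      simpa using h
    calc Real.log X - Real.log Y = Real.log (X / Y) := (Real.log_div (by linarith) hY0.ne').symm
      _ ≤ Real.log (bigT D) := Real.log_le_log (by positivity) hXYT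
      _ = L ^ (1.1 : ℝ) := by rw [bigT, Real.log_exp]
      _ ≤ L ^ 2 := h11
  -- Step E: combine
  have hdiff : SjOn c' D j (a12 χ) a25 (rngLow D) - main1212sum c' χ j =
      ((∑ n ∈ S, ∑ r ∈ n.divisors,
          (if Squarefree r then a n / (Nat.totient r : ℂ) * M n * N (n / r) r else 0)) -
        ∑ n ∈ S, a n * ((n : ℂ) / (Nat.totient n : ℂ)) * (A₀ n * c₀ * G n)) -
      K₁₂ * ∑ n ∈ (Finset.Ico 1 ⌈X⌉₊).filter (fun n => ¬ rngLow D n),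
          (‖χ (n : ZMod D)‖ : ℂ) * lamZero c' D j n / (Nat.totient n : ℂ) * Fpr n := by
    rw [hSj, hmainS, hmain_split]; ring
  rw [hdiff]
  refine (norm_sub_le _ _).trans ?_
  rw [norm_mul]
  -- currency: `w k = (L^k)⁻¹`
  have hw_le : ∀ {a b : ℕ}, a ≤ b → (L ^ b)⁻¹ ≤ (L ^ a)⁻¹ := fun hab =>
    inv_anti₀ (by positivity) (pow_le_pow_right₀ hL1 hab)
  have hw_mul : ∀ a b : ℕ, (L ^ a)⁻¹ * (L ^ b)⁻¹ = (L ^ (a + b))⁻¹ := fun a b => by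
    rw [← mul_inv, ← pow_add]
  have hLw : ∀ a b : ℕ, L ^ a * (L ^ (a + b))⁻¹ = (L ^ b)⁻¹ := fun a b => by
    rw [pow_add, mul_inv, ← mul_assoc, mul_inv_cancel₀ (by positivity), one_mul]
  have e256 : (1 : ℝ) ≤ Real.exp 256 := Real.one_le_exp (by norm_num)
  have hL9 : (1 : ℝ) ≤ L ^ 9 := one_le_pow₀ hL1
  have hL2 : (1 : ℝ) ≤ L ^ 2 := one_le_pow₀ hL1
  -- T1
  have hT1 : eB * (1 + Real.log Y) *
      ((a₀ * (L ^ 7)⁻¹ + m₀ * (L ^ 14)⁻¹) * (C₁₀ * (L ^ 15)⁻¹) +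
        m₀ * (L ^ 14)⁻¹ * ‖c₀‖ * 1) ≤
      2 * eB * ((a₀ + m₀) * C₁₀ + m₀ * c₀₀) * (L ^ 12)⁻¹ := by
    have hWle : eB * (1 + Real.log Y) ≤ 2 * eB * L ^ 9 := by
      have : eB * Real.log Y ≤ eB * L ^ 9 := by gcongr
      nlinarith
    have hF1pos : 0 ≤ (a₀ * (L ^ 7)⁻¹ + m₀ * (L ^ 14)⁻¹) * (C₁₀ * (L ^ 15)⁻¹) +
        m₀ * (L ^ 14)⁻¹ * ‖c₀‖ * 1 := by
      have : 0 ≤ (L ^ 7)⁻¹ := by positivity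
      have : 0 ≤ (L ^ 14)⁻¹ := by positivity
      have : 0 ≤ (L ^ 15)⁻¹ := by positivity
      positivity
    have hin : (a₀ * (L ^ 7)⁻¹ + m₀ * (L ^ 14)⁻¹) * (C₁₀ * (L ^ 15)⁻¹) +
        m₀ * (L ^ 14)⁻¹ * ‖c₀‖ * 1 ≤ ((a₀ + m₀) * C₁₀ + m₀ * c₀₀) * (L ^ 21)⁻¹ := by
      have hw7 : 0 ≤ (L ^ 7)⁻¹ := by positivity
      have hw14 : 0 ≤ (L ^ 14)⁻¹ := by positivity
      have i1 : a₀ * (L ^ 7)⁻¹ + m₀ * (L ^ 14)⁻¹ ≤ a₀ * (L ^ 7)⁻¹ + m₀ * (L ^ 7)⁻¹ :=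
        add_le_add le_rfl (mul_le_mul_of_nonneg_left (hw_le (by norm_num : 7 ≤ 14)) hm₀0)
      have i2 : C₁₀ * (L ^ 15)⁻¹ ≤ C₁₀ * (L ^ 14)⁻¹ :=
        mul_le_mul_of_nonneg_left (hw_le (by norm_num : 14 ≤ 15)) hC₁₀
      have i3 : m₀ * (L ^ 14)⁻¹ * ‖c₀‖ * 1 ≤ m₀ * (L ^ 14)⁻¹ * (c₀₀ * (L ^ 7)⁻¹) * 1 := by
        rw [mul_one, mul_one]
        exact mul_le_mul_of_nonneg_left hc₀ (mul_nonneg hm₀0 hw14)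
      have i12 : (a₀ * (L ^ 7)⁻¹ + m₀ * (L ^ 14)⁻¹) * (C₁₀ * (L ^ 15)⁻¹) ≤
          (a₀ * (L ^ 7)⁻¹ + m₀ * (L ^ 7)⁻¹) * (C₁₀ * (L ^ 14)⁻¹) :=
        mul_le_mul i1 i2 (by positivity) (by positivity)
      calc (a₀ * (L ^ 7)⁻¹ + m₀ * (L ^ 14)⁻¹) * (C₁₀ * (L ^ 15)⁻¹) + m₀ * (L ^ 14)⁻¹ * ‖c₀‖ * 1
          ≤ (a₀ * (L ^ 7)⁻¹ + m₀ * (L ^ 7)⁻¹) * (C₁₀ * (L ^ 14)⁻¹) +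
              m₀ * (L ^ 14)⁻¹ * (c₀₀ * (L ^ 7)⁻¹) * 1 := add_le_add i12 i3
        _ = ((a₀ + m₀) * C₁₀ + m₀ * c₀₀) * ((L ^ 7)⁻¹ * (L ^ 14)⁻¹) := by ring
        _ = ((a₀ + m₀) * C₁₀ + m₀ * c₀₀) * (L ^ 21)⁻¹ := by rw [hw_mul]
    calc eB * (1 + Real.log Y) *
          ((a₀ * (L ^ 7)⁻¹ + m₀ * (L ^ 14)⁻¹) * (C₁₀ * (L ^ 15)⁻¹) + m₀ * (L ^ 14)⁻¹ * ‖c₀‖ * 1)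
        ≤ (2 * eB * L ^ 9) * (((a₀ + m₀) * C₁₀ + m₀ * c₀₀) * (L ^ 21)⁻¹) :=
          mul_le_mul hWle hin hF1pos (by positivity)
      _ = 2 * eB * ((a₀ + m₀) * C₁₀ + m₀ * c₀₀) * (L ^ 9 * (L ^ (9 + 12))⁻¹) := by
          norm_num; ring
      _ = 2 * eB * ((a₀ + m₀) * C₁₀ + m₀ * c₀₀) * (L ^ 12)⁻¹ := by rw [hLw]
  -- T3
  have hT3 : ‖K₁₂‖ * ‖∑ n ∈ (Finset.Ico 1 ⌈X⌉₊).filter (fun n => ¬ rngLow D n),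
      (‖χ (n : ZMod D)‖ : ℂ) * lamZero c' D j n / (Nat.totient n : ℂ) * Fpr n‖ ≤
      4 * Real.exp 256 * k₀ * fpr * (L ^ 12)⁻¹ := by
    have hk14 : 0 ≤ k₀ * (L ^ 14)⁻¹ := mul_nonneg hk₀0 (inv_nonneg.mpr (pow_nonneg hL0.le 14))
    have hlXY : Real.log Y ≤ Real.log X := Real.log_le_log hY0 hYX
    have hlog4 : 3 + Real.log X - Real.log Y ≤ 4 * L ^ 2 := by linarith
    calc ‖K₁₂‖ * ‖∑ n ∈ (Finset.Ico 1 ⌈X⌉₊).filter (fun n => ¬ rngLow D n),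
          (‖χ (n : ZMod D)‖ : ℂ) * lamZero c' D j n / (Nat.totient n : ℂ) * Fpr n‖
        ≤ ‖K₁₂‖ * (fpr * (Real.exp 256 * (3 + Real.log X - Real.log Y))) :=
          mul_le_mul_of_nonneg_left hwindow (norm_nonneg K₁₂)
      _ ≤ (k₀ * (L ^ 14)⁻¹) * (fpr * (Real.exp 256 * (3 + Real.log X - Real.log Y))) := by
          refine mul_le_mul_of_nonneg_right hK₁₂n ?_
          have : 0 ≤ 3 + Real.log X - Real.log Y := by linarith
          positivity
      _ ≤ (k₀ * (L ^ 14)⁻¹) * (fpr * (Real.exp 256 * (4 * L ^ 2))) := by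
          refine mul_le_mul_of_nonneg_left ?_ hk14
          exact mul_le_mul_of_nonneg_left (mul_le_mul_of_nonneg_left hlog4 (by positivity)) hfpr0
      _ = 4 * Real.exp 256 * k₀ * fpr * (L ^ 2 * (L ^ (2 + 12))⁻¹) := by norm_num; ring
      _ = 4 * Real.exp 256 * k₀ * fpr * (L ^ 12)⁻¹ := by rw [hLw]
  have hF1 : 0 ≤ (a₀ * (L ^ 7)⁻¹ + m₀ * (L ^ 14)⁻¹) * (C₁₀ * (L ^ 15)⁻¹) +
      m₀ * (L ^ 14)⁻¹ * ‖c₀‖ * 1 := by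
    have : 0 ≤ (L ^ 7)⁻¹ := by positivity
    have : 0 ≤ (L ^ 14)⁻¹ := by positivity
    have : 0 ≤ (L ^ 15)⁻¹ := by positivity
    positivity
  have step := hassembly.trans ((mul_le_mul_of_nonneg_right hW₁ hF1).trans hT1)
  have hsum := add_le_add step hT3
  refine hsum.trans (le_of_eq ?_)
  rw [hK]; ring

/-! ## The edge: (12.12) from Lemma 8.2 and (12.10) in the Euler-majorant currency -/

/-- **(12.12), first equality, from Lemma 8.2 and (12.10) in the Euler-majorant currency**: for every
`ε > 0` and all large `D` (under (A), for `𝐚₂₅ = conj(χϰ₁₃)`, `j ∈ {1,2,3}`),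
`‖S_j(𝐚₁₂,𝐚₂₅)|_{dr≤P″₁/T} − L′(1,χ)²b*β_{j+1}β_{j+2}Σ_{n<P^{0.496}}|χ(n)|λ₀ⱼ(n)φ(n)⁻¹(…)‖ ≤ εα`, given
Lemma 8.2 (`Skeleton.Lemma82 c′`, a tree theorem for `c′ ≥ 0`) and (12.10) in the reading
`Sec12B.Eq1210L15RelA c′` (`TypedSection12BRel`). [cite: Zhang2022LandauSiegel, §12 (12.12) p.71, tex L3605–L3612] -/
theorem eq1212_first_of_eq1210L15RelA (h82 : Lemma82 c') (h1210 : Sec12B.Eq1210L15RelA c') :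
    ∀ ε : ℝ, 0 < ε → ForAllLarge fun D _ χ => AssumptionA D χ →
      ∀ a25 : ℕ → ℂ, (∀ n, a25 n = conj (χ (n : ZMod D) * vk13 D n)) →
        ∀ j ∈ ({1, 2, 3} : Finset ℕ),
          ‖SjOn c' D j (a12 χ) a25 (rngLow D) - main1212sum c' χ j‖ ≤ ε * alpha D := by
  intro ε hε
  obtain ⟨C₉a, h9⟩ := Section9Discharge.step9u002_sharp c' h82
  obtain ⟨C₉b, h8⟩ := Section9Discharge.step8u041_of_lemma82 c' h82
  obtain ⟨C₁₀, A, hA0, h10⟩ := h1210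
  obtain ⟨K, hK0, hcore⟩ := eq1212_first_core_relA c' (C₉ := max (max C₉a C₉b) 0) (C₁₀ := max C₁₀ 0)
    (A := A) (le_max_right _ _) (le_max_right _ _) hA0
  obtain ⟨D₁, hD₁⟩ := Sec14.Eq143.four_D_t0_sq_le_bigT
  obtain ⟨D₂, hD₂⟩ := exists_nat_forall_le_ell (K / (ε * π) + 5)
  have hbig : ForAllLarge fun D _ _ => 4 * (D : ℝ) * t0 D ^ 2 ≤ bigT D ∧ K / (ε * π) + 5 ≤ ell D :=
    ⟨max D₁ D₂, fun D _ _ hD _ _ =>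
      ⟨hD₁ D (le_trans (le_max_left _ _) hD), hD₂ D (le_trans (le_max_right _ _) hD)⟩⟩
  refine ((((h9.and h8).and h10).and (Sec10C.forAllLarge_five_c c')).and hbig).mono ?_
  intro D _ χ hq hp hh hA a25 ha25 j hj
  obtain ⟨⟨⟨⟨H9, H8⟩, H10⟩, ⟨-, hℓ6, hc5⟩⟩, ⟨hT4, hℓK⟩⟩ := hh
  have hℓ5 : 5 ≤ ell D := by linarith
  have hL1 : 1 ≤ ell D := by linarith
  have hL0 : 0 < ell D := by linarith
  have hi15 : 0 ≤ (ell D ^ 15)⁻¹ := by positivity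
  have H9' : ∀ d r : ℕ, 1 ≤ d → 1 ≤ r → ((d * r : ℕ) : ℝ) < Skeleton.P3 D / bigT D →
      ‖(∑ m ∈ Finset.Ico 1 (Nsupp D),
            χ (m : ZMod D) * vk3 D (d * r * m) / (m : ℂ) ^ (1 - betaJ c' D j)) -
          deriv χ.LFunction 1 / (Real.log (Skeleton.P3 D) : ℂ) *
            frakfW c' D j 6 (Skeleton.P3 D / ((d * r : ℕ) : ℝ))‖ ≤
        max (max C₉a C₉b) 0 * (ell D ^ 15)⁻¹ := fun d r hd hr h =>
    (H9 hA j hj d r hd hr h).trans (mul_le_mul_of_nonneg_right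
      ((le_max_left _ _).trans (le_max_left _ _)) hi15)
  have H8' : ∀ d r : ℕ, 1 ≤ d → 1 ≤ r → ((d * r : ℕ) : ℝ) < Skeleton.P2 D / bigT D →
      ‖(∑ m ∈ Finset.Ico 1 (Nsupp D),
            χ (m : ZMod D) * vk2 D (d * r * m) / (m : ℂ) ^ (1 - betaJ c' D j)) -
          deriv χ.LFunction 1 / (Real.log (Skeleton.P2 D) : ℂ) *
            frakfW c' D j 7 (Skeleton.P2 D / ((d * r : ℕ) : ℝ))‖ ≤
        max (max C₉a C₉b) 0 * (ell D ^ 15)⁻¹ := fun d r hd hr h =>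
    (H8 hA j hj d r hd hr h).trans (mul_le_mul_of_nonneg_right
      ((le_max_right _ _).trans (le_max_left _ _)) hi15)
  have H10' : ∀ d r : ℕ, 1 ≤ d → 1 ≤ r → ((d * r : ℕ) : ℝ) ≤ P1pp D / bigT D →
      ‖Sec12B.sum122 c' χ j d r - Sec12B.main1210 c' χ j d r‖ ≤
        max C₁₀ 0 * (ell D ^ 15)⁻¹ * ∏ q ∈ (d * r).primeFactors, (1 + A / (q : ℝ)) :=
    fun d r hd hr h => (H10 hA j hj d r hd hr h).trans
      (mul_le_mul_of_nonneg_right (mul_le_mul_of_nonneg_right (le_max_left _ _) hi15)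
        (Finset.prod_nonneg fun q _ => by positivity))
  have key := hcore hq hp hℓ5 hc5 hT4 j H9' H8' H10' a25 ha25
  -- `K𝓛⁻¹² ≤ εα`
  obtain ⟨hαpos, hαeq, -⟩ := alpha_facts (D := D) (by linarith)
  have hKle : K ≤ ε * π * ell D := by
    have h1 : K / (ε * π) ≤ ell D := by linarith
    have := (div_le_iff₀ (by positivity)).mp h1
    linarith
  refine key.trans ?_
  rw [hαeq]
  calc K * (ell D ^ 12)⁻¹ ≤ ε * π * ell D * (ell D ^ 12)⁻¹ :=
        mul_le_mul_of_nonneg_right hKle (by positivity)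
    _ = ε * (π / ell D ^ 9) * (ell D ^ 2)⁻¹ := by field_simp
    _ ≤ ε * (π / ell D ^ 9) * 1 :=
        mul_le_mul_of_nonneg_left (inv_le_one_of_one_le₀ (one_le_pow₀ hL1)) (by positivity)
    _ = ε * (π / ell D ^ 9) := mul_one _

/-- **The leaf `Typed.Sec12C.Eq1212 c′` ((12.12), both equalities) from Lemma 8.2 and (12.10) in the
Euler-majorant currency**: `Lemma82 c′ → Sec12B.Eq1210L15RelA c′ → Eq1212 c′` (first equality:
`eq1212_first_of_eq1210L15RelA`; second equality: `eq1212_sum_sub_int`, `Section12Eq1212Integral`).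
[cite: Zhang2022LandauSiegel, §12 (12.12) p.71, Lemma 12.2 (12.10) p.69] -/
theorem eq1212_of_eq1210L15RelA (h82 : Lemma82 c') (h1210 : Sec12B.Eq1210L15RelA c') :
    Eq1212 c' :=
  eq1212_of_first_equality c' (eq1212_first_of_eq1210L15RelA c' h82 h1210)

/-- **The leaf `Typed.Sec12C.Eq1212 c′` from (12.10) in the Euler-majorant currency alone, for `c′ ≥ 0`**
(Lemma 8.2 is a theorem of the tree, `Skeleton.lemma82_holds`): `0 ≤ c′ → Sec12B.Eq1210L15RelA c′ →
Eq1212 c′` — the closer shape for the skeleton pen (`hc′ : 0 ≤ c′` is in scope in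
`theorem1_of_leaves_v26`); plug `h1212 := eq1212_of_eq1210L15RelA' hc' (eq1210L15RelA_holds c')` once the
u024/u025 cores land in ANY of the three currencies (`Sec12B.eq1210L15RelA_of_u024RelA_u025Rel`,
`eq1210L15RelA_of_u024Rel_u025Rel`, `eq1210L15RelA_of_eq1210L15Rel`, `Section12RelEdgesA`).
[cite: Zhang2022LandauSiegel, §12 (12.12) p.71, Lemma 12.2 (12.10) p.69] -/
theorem eq1212_of_eq1210L15RelA' {c' : ℝ} (hc' : 0 ≤ c') (h1210 : Sec12B.Eq1210L15RelA c') :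
    Eq1212 c' :=
  eq1212_of_eq1210L15RelA c' (lemma82_holds hc') h1210

/-- **The leaf `Typed.Sec12C.Eq1212 c′` from the u024/u025 circle claims in the Euler-majorant / relative
currencies, for `c′ ≥ 0`**: `0 ≤ c′ → Sec12B.U024RelA c′ → Sec12B.U025Rel c′ → Eq1212 c′` (via the
PROVED Cauchy-step and gathering edges `Sec12B.eq1210L15RelA_of_u024RelA_u025Rel`, `Section12RelEdgesA`).
[cite: Zhang2022LandauSiegel, §12 (12.12) p.71, proof of Lemma 12.2 pp.69–70] -/
theorem eq1212_of_u024RelA_u025Rel {c' : ℝ} (hc' : 0 ≤ c') (h24 : Sec12B.U024RelA c')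
    (h25 : Sec12B.U025Rel c') : Eq1212 c' :=
  eq1212_of_eq1210L15RelA' hc' (Sec12B.eq1210L15RelA_of_u024RelA_u025Rel c' h24 h25)

/- Remark (no declaration, dedup): the edge out of the Lemma 8.3/8.4 currency `(∏_{q∣dr}(1−q⁻¹)⁻¹)²`,
`0 ≤ c′ → Sec12B.Eq1210L15Rel c′ → Eq1212 c′`, is zl-w12-p10's `eq1212_of_eq1210L15Rel'`
(`Section12Eq1212OfRel`); it is also the term
`fun hc' h => eq1212_of_eq1210L15RelA' hc' (Sec12B.eq1210L15RelA_of_eq1210L15Rel c' h)`, i.e. ONE consumer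
edge (this file's) serves all three typed currencies of (12.10). -/

end Core

end Literature.NumberTheory.LFunctions.Zhang2022.Typed.Sec12C
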